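import Mathlib
import Summits.Langlands.Langlands.Theorems.QuadraticWindowHostInducedRepSignedTwistAux
import Literature.NumberTheory.Automorphic.NormGroupClosedProofs
import Literature.NumberTheory.Automorphic.ClassFieldCharacterLocal

/-!
# The automorphic package of line `one-transparent-pane` — stub `stub_package` of the crux
# `Summit.Langlands.Langlands.Theses.QuadraticWindow.HostInducedRep` (stmt-Langlands-10902):
# helper file 4 — restriction of Hecke characters along `𝕀_{F₀} → 𝕀_K`

LOG (worker `stub_package`, 2026-08-16; full log and inventory in helper file 1,
`QuadraticWindowHostInducedRepPackage.lean`).  FACT-FREE; no definition (the restriction is given as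
an existence theorem, which is all the member construction consumes).

The member construction of `stub_package` forms the inverse polarization character
`θ = (χ_e · ψ|_{𝔸_{F₀}^×} · ω^ε)⁻¹` of `π ⊗ ψ` as a Hecke character of `F₀`, where `ψ` is a Hecke
character of `F`; and it prescribes the extension `ψ₀` of a character of `F₀` to `K` through the
identity `ψ₀ ∘ (𝕀_{F₀} → 𝕀_K) = θ · ξ` (hypothesis `hext` of the sub-stub `pkg_member`).  Both need
the **restriction** `χ|_{𝕀_{F₀}}` of a Hecke character `χ` of an extension `K/F₀` along the base
change of ideles `AdeleRing.ideleBaseChange F₀ K` (continuous, `continuous_ideleBaseChange`;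
principal ideles to principal ideles, `ideleBaseChange_mem_principalIdeles`), and its local
behaviour: `(χ|_{𝕀_{F₀}})_v = ∏_{w ∣ v} χ_w ∘ (F₀,v → K_w)` (`ideleBaseChange_localUnits`), whence
unramifiedness below unramified places and, over a place unramified in `K`, the value at a
uniformizer `χ|(ϖ_v) = ∏_{w ∣ v} χ(ϖ_w)` (a uniformizer of `F₀,v` stays one in `K_w` when
`e(w∣v) = 1`, `valued_adicCompletionOfLiesOver`).
(The norm shifts `ψ₁ = ψ₀ ‖·‖^z` at uniformizers live in helper file 3, `…PackageDict.lean`.)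
(Cassels–Fröhlich, Ch. II §14, Ch. VII §4.3; Neukirch, Ch. VI §1–2.) [folklore]
-/

open scoped BigOperators
open IsDedekindDomain NumberField
open Literature.NumberTheory.Automorphic Literature.NumberTheory.GaloisRepresentations
open Summit.Langlands.Langlands.Theorems.HostInducedRep.GrsExplicitDescent

-- `Summit.Langlands.Langlands.…` (summit = sub-problem name, D-0017 layout) trips `dupNamespace`.
set_option linter.dupNamespace false

noncomputable section

namespace Summit.Langlands.Langlands.Theorems.HostInducedRep.OneTransparentPane

section Restrict

variable (F₀ : Type) {K : Type} [Field F₀] [NumberField F₀] [Field K] [NumberField K] [Algebra F₀ K]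

/-- **Restriction of a Hecke character along `𝕀_{F₀} → 𝕀_K`.**  For a Hecke character `χ` of `K`
there is a Hecke character `χ|_{F₀}` of `F₀` with `χ|_{F₀}(x) = χ(x_K)` for every idele `x` of `F₀`
(`x_K` its base change): the composite is continuous and kills the principal ideles of `F₀`, whose
base changes are principal. [folklore] -/
theorem heckeCharacter_exists_restrict (χ : HeckeCharacter K) :
    ∃ χ₀ : HeckeCharacter F₀, ∀ x, χ₀ x = χ (AdeleRing.ideleBaseChange F₀ K x) :=
  ⟨{ toContinuousMonoidHom :=
      { toMonoidHom := χ.toContinuousMonoidHom.toMonoidHom.comp (AdeleRing.ideleBaseChange F₀ K)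
        continuous_toFun := (map_continuous χ).comp (continuous_ideleBaseChange F₀ K) }
     map_principal' := fun _ hx ↦ χ.map_principal (ideleBaseChange_mem_principalIdeles F₀ K hx) },
    fun _ ↦ rfl⟩

variable {F₀}

/-- The restriction of a unitary Hecke character is unitary. [folklore] -/
theorem isUnitary_of_restrict {χ : HeckeCharacter K} {χ₀ : HeckeCharacter F₀}
    (h : ∀ x, χ₀ x = χ (AdeleRing.ideleBaseChange F₀ K x)) (hχ : χ.IsUnitary) : χ₀.IsUnitary :=
  fun x ↦ by rw [h]; exact hχ _

/-- The restriction of a finite-order Hecke character has finite order. [folklore] -/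
theorem isFiniteOrder_of_restrict {χ : HeckeCharacter K} {χ₀ : HeckeCharacter F₀}
    (h : ∀ x, χ₀ x = χ (AdeleRing.ideleBaseChange F₀ K x)) (hχ : χ.IsFiniteOrder) :
    χ₀.IsFiniteOrder := by
  obtain ⟨N, hN, hχN⟩ := hχ.exists_pow_eq_one
  refine isOfFinOrder_iff_pow_eq_one.mpr ⟨N, hN, HeckeCharacter.ext fun x ↦ ?_⟩
  have := congrArg (fun ψ : HeckeCharacter K ↦ ψ (AdeleRing.ideleBaseChange F₀ K x)) hχN
  simp only [HeckeCharacter.pow_apply, HeckeCharacter.one_apply] at this ⊢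
  rw [h]
  exact this

/-- **The local component of the restriction**: `(χ|_{F₀})_v(u) = ∏_{w ∣ v} χ_w(u)` for `u ∈ F₀,vˣ`
viewed in each `K_w` (`ideleBaseChange_localUnits`). [folklore] -/
theorem localComponent_restrict {χ : HeckeCharacter K} {χ₀ : HeckeCharacter F₀}
    (h : ∀ x, χ₀ x = χ (AdeleRing.ideleBaseChange F₀ K x)) (v : HeightOneSpectrum (𝓞 F₀))
    (u : (v.adicCompletion F₀)ˣ) (c : ∀ w : HeightOneSpectrum (𝓞 K), (w.adicCompletion K)ˣ)
    (hc : ∀ (w : HeightOneSpectrum (𝓞 K)) (_ : w.under (𝓞 F₀) = v) [w.asIdeal.LiesOver v.asIdeal],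
      (c w : w.adicCompletion K) = adicCompletionOfLiesOver F₀ K v w (u : v.adicCompletion F₀)) :
    χ₀.localComponent v u =
      ∏ w ∈ (finite_fibre (F := K) v).toFinset, χ.localComponent w (c w) := by
  rw [HeckeCharacter.localComponent_apply, h,
    ideleBaseChange_localUnits K v u c hc (finite_fibre (F := K) v).toFinset
      (fun w ↦ by rw [Set.Finite.mem_toFinset, Set.mem_setOf_eq]), map_prod]
  rfl

/-- **The restriction is unramified below unramified places**: if `χ` is unramified at every place
of `K` above `v`, then `χ|_{F₀}` is unramified at `v` (a unit of `𝒪_v` is a unit of every `𝒪_w`,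
`w ∣ v`). [folklore] -/
theorem isUnramifiedAt_restrict {χ : HeckeCharacter K} {χ₀ : HeckeCharacter F₀}
    (h : ∀ x, χ₀ x = χ (AdeleRing.ideleBaseChange F₀ K x)) {v : HeightOneSpectrum (𝓞 F₀)}
    (hv : ∀ w : HeightOneSpectrum (𝓞 K), w.under (𝓞 F₀) = v → χ.IsUnramifiedAt w) :
    χ₀.IsUnramifiedAt v := by
  intro u
  obtain ⟨c, hc, -⟩ := exists_localUnitsAbove (F := F₀) K v
    (Units.map ((v.adicCompletionIntegers F₀).subtype : _ →* _) u)
  rw [localComponent_restrict h v _ c hc]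
  refine Finset.prod_eq_one fun w hw ↦ ?_
  have hwv : w.under (𝓞 F₀) = v := by
    rw [Set.Finite.mem_toFinset, Set.mem_setOf_eq] at hw; exact hw
  haveI : w.asIdeal.LiesOver v.asIdeal := ⟨(congrArg HeightOneSpectrum.asIdeal hwv).symm⟩
  -- `c w` is a unit of `𝒪_w`
  have hval : Valued.v ((c w : (w.adicCompletion K)ˣ) : w.adicCompletion K) = 1 := by
    rw [hc w hwv, valued_adicCompletionOfLiesOver]
    have hu : Valued.v (((Units.map ((v.adicCompletionIntegers F₀).subtype : _ →* _) u :
        (v.adicCompletion F₀)ˣ) : v.adicCompletion F₀)) = 1 := by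
      change Valued.v ((u : v.adicCompletionIntegers F₀) : v.adicCompletion F₀) = 1
      exact Valuation.Integers.one_of_isUnit (Valuation.integer.integers _) u.isUnit
    rw [hu, one_pow]
  let d₀ : (w.adicCompletionIntegers K)ˣ :=
    ⟨⟨c w, (HeightOneSpectrum.mem_adicCompletionIntegers (R := 𝓞 K) K w).mpr hval.le⟩,
      ⟨(((c w)⁻¹ : (w.adicCompletion K)ˣ) : w.adicCompletion K),
        (HeightOneSpectrum.mem_adicCompletionIntegers (R := 𝓞 K) K w).mpr (by
          rw [Units.val_inv_eq_inv_val, map_inv₀, hval, inv_one])⟩,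
      Subtype.ext (c w).mul_inv, Subtype.ext (c w).inv_mul⟩
  have hd₀ : Units.map ((w.adicCompletionIntegers K).subtype : _ →* _) d₀ = c w := Units.ext rfl
  rw [← hd₀]
  exact hv w hwv d₀

/-- **The value of the restriction at a uniformizer over a place unramified in `K`**: if every
place `w ∣ v` of `K` has `e(w∣v) = 1` and `χ` is unramified above `v`, then
`χ|_{F₀}(ϖ_v) = ∏_{w ∣ v} χ(ϖ_w)` (a uniformizer of `F₀,v` is a uniformizer of each `K_w`).  At a
place split in a quadratic `K` this reads `χ|(ϖ_v) = χ(ϖ_u) χ(ϖ_{ū})`, at an inert one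
`χ|(ϖ_v) = χ(ϖ_u)`. [folklore] -/
theorem valueAtUniformizer_restrict {χ : HeckeCharacter K} {χ₀ : HeckeCharacter F₀}
    (h : ∀ x, χ₀ x = χ (AdeleRing.ideleBaseChange F₀ K x)) {v : HeightOneSpectrum (𝓞 F₀)}
    (he : ∀ w : HeightOneSpectrum (𝓞 K), w.under (𝓞 F₀) = v → w.asIdeal.ramificationIdx (𝓞 F₀) = 1)
    (hv : ∀ w : HeightOneSpectrum (𝓞 K), w.under (𝓞 F₀) = v → χ.IsUnramifiedAt w) :
    χ₀.valueAtUniformizer v =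
      ∏ w ∈ (finite_fibre (F := K) v).toFinset, χ.valueAtUniformizer w := by
  obtain ⟨c, hc, -⟩ := exists_localUnitsAbove (F := F₀) K v (HeckeCharacter.uniformizer F₀ v)
  unfold HeckeCharacter.valueAtUniformizer
  rw [localComponent_restrict h v _ c hc, Units.coe_prod]
  refine Finset.prod_congr rfl fun w hw ↦ ?_
  have hwv : w.under (𝓞 F₀) = v := by
    rw [Set.Finite.mem_toFinset, Set.mem_setOf_eq] at hw; exact hw
  haveI : w.asIdeal.LiesOver v.asIdeal := ⟨(congrArg HeightOneSpectrum.asIdeal hwv).symm⟩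
  refine HeckeCharacter.localComponent_eq_valueAtUniformizer (hv w hwv) ?_
  rw [hc w hwv, valued_adicCompletionOfLiesOver, HeckeCharacter.valued_uniformizer,
    Ideal.ramificationIdx'_eq_ramificationIdx v.asIdeal w.asIdeal v.ne_bot, he w hwv, pow_one]

end Restrict

/-- **Registered anchor** of this helper file (stub registry of stmt-Langlands-10902, line
`one-transparent-pane`, package helper "Hecke"): restriction of Hecke characters along `𝕀_{F₀} → 𝕀_K`
(`heckeCharacter_exists_restrict`). [folklore] -/
theorem packageHecke_anchor : ∀ (F₀ K : Type) [Field F₀] [NumberField F₀] [Field K] [NumberField K] [Algebra F₀ K] (χ : HeckeCharacter K), ∃ χ₀ : HeckeCharacter F₀, ∀ x, χ₀ x = χ (AdeleRing.ideleBaseChange F₀ K x) :=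
  fun F₀ _ _ _ _ _ _ χ ↦ heckeCharacter_exists_restrict F₀ χ

end Summit.Langlands.Langlands.Theorems.HostInducedRep.OneTransparentPane

end
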